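/-
Copyright (c) 2026 the pub-hodgecm-mathlib formalisation cell (harness21).  Prover seat hodgecm-mathlib-K2E3-p03 (g2), Track B «K2-LIT» ∕ h413, road J ∕ R3 (r)-class step (A):
the orders of the two binary ORTHOGONAL groups over a finite field of odd characteristic.
-/
import Literature.FieldTheory.FiniteFields.ConicCharacterSumTransferAffine   -- ★ `ConicTransfer.sum_unitConic_eq_parametrisation` (points of the unit conic)
import Literature.NumberTheory.Automorphic.UnitaryGroupAutomorphicRep          -- ★ `unitaryGroupOfForm`, `mem_unitaryGroupOfForm_iff`
import HarnessLib

/-!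
# The binary orthogonal groups over `𝔽_q`, `q` odd: `#O(H)(𝔽_q) = 2(q − 1)` for the hyperbolic plane `H = antidiag(1,1)` and `#O(⟨1,−d⟩)(𝔽_q) = 2(q + 1)` for `d` a non-square
# (Lidl–Niederreiter Ch. 6 §2 Thm. 6.26; Wilson 2009 §3.7)

Topic `GroupTheory/SpecificGroups`; namespace `Literature.GroupTheory.SpecificGroups` (sibling of ★ `FiniteUnitaryGroupCard`, ★ `FiniteSymplecticGroupCard`).  THEOREMS ONLY (no definition,
no instance, no notation, no axiom, no named fact, no `sorry`); kernel lane `--kind proof --supports stmt-HodgeConjecture-24833` (count-neutral).  Cell `pub/hodgecm-mathlib`, crux H413,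
Track B «K2-LIT», road J of ‹S›, letter ‹J3› `sig_K2E3CompatibleMeasureEPIdentityRankOne` (v2), (r)-class = ramified `v ∤ 2` (K2E3-p03 (g2) count plan 2026-09-04, step (A)): at a tamely
ramified place the residue involution is trivial, so the reduction of `U(J)(𝒪_w)` lands in the finite ORTHOGONAL group `O(J̄)(𝔽_q)` = the tree's `unitaryGroupOfForm (RingHom.id 𝓀) J̄`
(★ `unitary_residueHom_surjective_of_isUnit_two` makes it onto); the two rank-2 blocks of ‹J3› reduce to the hyperbolic plane (dock block `Φ₂`) and to the anisotropic plane `⟨1,−ξ̄⟩`,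
`ξ̄` a non-square (compact block, `ξ` a non-norm unit).
* §1 `card_filter_sq_sub_mul_sq_eq_one` — the conic `a² − d·c² = 1` has `q + 1` points for `d` a non-square (★ rational parametrisation, no point at infinity).
* §2 **`natCard_unitaryGroupOfForm_id_antidiag_one`**: `O(antidiag(1,1))(𝔽_q) = {diag(a,a⁻¹)} ⊔ {antidiag(a,a⁻¹)} ≃ 𝔽_qˣ ⊕ 𝔽_qˣ`, order `2(q−1)`.
* §3 `eq_of_mem_unitaryGroupOfForm_id_diag` (every member is `[[a, εdc],[c, εa]]`, `ε = det = ±1`, `a² − dc² = 1`),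
  **`natCard_unitaryGroupOfForm_id_diag_one_neg`**: order `2(q+1)`.
HONEST LABEL: finite-field algebra, count-neutral; HC_CM is proved only modulo the 7 printed citations (2 remaining: hLiu418 = `stmt-HodgeConjecture-24832`, h413 = `stmt-HodgeConjecture-24833`)
until rung 0 closes.

## References
* [LidlNiederreiter1996] R. Lidl, H. Niederreiter, *Finite Fields*, 2nd ed. (1996), Ch. 6 §2, Thm. 6.26–6.27 (points on conics).
* [Wilson2009] R. A. Wilson, *The Finite Simple Groups*, GTM 251 (2009), §3.7 (orders of the orthogonal groups `GO₂^±(q) ≅ D_{2(q∓1)}`).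
-/

set_option autoImplicit false

noncomputable section

open Matrix Finset Literature.NumberTheory.Automorphic

namespace Literature.GroupTheory.SpecificGroups

variable {k : Type*} [Field k] [Fintype k] [DecidableEq k]

/-! ## §1 Points of the anisotropic unit conic -/

/-- **`#{(a,c) ∈ 𝔽_q² : a² − d c² = 1} = q + 1`** for `d` a non-square, `q` odd: the rational parametrisation from `(1,0)` (★ `sum_unitConic_eq_parametrisation`) is a bijection with
`{x : x² ≠ d} ⊔ {pt} = 𝔽_q ⊔ {pt}`. [cite: LidlNiederreiter1996, Ch. 6 §2 Thm. 6.26] -/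
theorem card_filter_sq_sub_mul_sq_eq_one (hF : ringChar k ≠ 2) {d : k} (hd : ¬ IsSquare d) :
    (univ.filter fun p : k × k => p.1 ^ 2 - d * p.2 ^ 2 = 1).card = Fintype.card k + 1 := by
  have hd0 : d ≠ 0 := fun h => hd (h ▸ IsSquare.zero)
  have hfilter : (univ.filter fun p : k × k => p.1 ^ 2 - d * p.2 ^ 2 = 1) = univ.filter fun p : k × k => p.1 ^ 2 + (-d) * p.2 ^ 2 = 1 := by
    refine Finset.filter_congr fun p _ => ?_
    rw [neg_mul, ← sub_eq_add_neg]
  have hall : (univ.filter fun x : k => x ^ 2 + (-d) ≠ 0) = univ := by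
    refine Finset.filter_true_of_mem fun x _ h => hd ⟨x, ?_⟩
    linear_combination -h
  have h := Literature.FieldTheory.FiniteFields.ConicTransfer.sum_unitConic_eq_parametrisation hF (neg_ne_zero.2 hd0) (fun _ => (1 : ℤ))
  rw [← hfilter, hall, Finset.sum_const, Finset.sum_const, nsmul_eq_mul, nsmul_eq_mul, mul_one, mul_one, Finset.card_univ] at h
  exact_mod_cast h.trans (add_comm _ _)

/-! ## §2 The hyperbolic plane: `#O(antidiag(1,1))(𝔽_q) = 2(q − 1)` -/

omit [Fintype k] [DecidableEq k] in
/-- Entries of `gᵀ · antidiag(1,1) · g`: `(i,j) ↦ g₀ᵢ g₁ⱼ + g₁ᵢ g₀ⱼ`. [folklore] -/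
private theorem transpose_mul_antidiag_mul_apply (g : Matrix (Fin 2) (Fin 2) k) (i j : Fin 2) :
    (gᵀ * !![(0 : k), 1; 1, 0] * g) i j = g 0 i * g 1 j + g 1 i * g 0 j := by
  simp [Matrix.mul_apply, Fin.sum_univ_two, Matrix.transpose_apply]; ring

/-- **`#O(antidiag(1,1))(𝔽_q) = 2(q − 1)`** (`q` odd): a member `[[a,b],[c,d']]` has `2ac = 2bd' = 0`, `ad' + bc = 1`, so it is `diag(a, a⁻¹)` (`a ≠ 0`) or `antidiag(b, b⁻¹)` (`a = 0`):
`O ≃ 𝔽_qˣ ⊔ 𝔽_qˣ`. [cite: Wilson2009, §3.7] [cite: LidlNiederreiter1996, Ch. 6 §2 Thm. 6.26] -/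
theorem natCard_unitaryGroupOfForm_id_antidiag_one (hF : ringChar k ≠ 2) :
    Nat.card ↥(unitaryGroupOfForm (RingHom.id k) !![(0 : k), 1; 1, 0]) = 2 * (Fintype.card k - 1) := by
  have h20 : (2 : k) ≠ 0 := Ring.two_ne_zero hF
  have hmem : ∀ g : GL (Fin 2) k, g ∈ unitaryGroupOfForm (RingHom.id k) !![(0 : k), 1; 1, 0] ↔
      (g : Matrix (Fin 2) (Fin 2) k)ᵀ * !![(0 : k), 1; 1, 0] * (g : Matrix (Fin 2) (Fin 2) k) = !![(0 : k), 1; 1, 0] := fun g => by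
    rw [mem_unitaryGroupOfForm_iff, RingHom.coe_id, Matrix.map_id]
  -- the three relations of a member
  have hrel : ∀ g : ↥(unitaryGroupOfForm (RingHom.id k) !![(0 : k), 1; 1, 0]),
      (g : GL (Fin 2) k) 0 0 * (g : GL (Fin 2) k) 1 0 = 0 ∧ (g : GL (Fin 2) k) 0 0 * (g : GL (Fin 2) k) 1 1 + (g : GL (Fin 2) k) 1 0 * (g : GL (Fin 2) k) 0 1 = 1 ∧
        (g : GL (Fin 2) k) 0 1 * (g : GL (Fin 2) k) 1 1 = 0 := by
    intro g
    have h := (hmem g.1).1 g.2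
    have h00 := congr_fun (congr_fun h 0) 0
    have h01 := congr_fun (congr_fun h 0) 1
    have h11 := congr_fun (congr_fun h 1) 1
    rw [transpose_mul_antidiag_mul_apply] at h00 h01 h11
    simp only [Matrix.of_apply, Matrix.cons_val', Matrix.cons_val_zero, Matrix.cons_val_one, Matrix.cons_val_fin_one, Matrix.empty_val'] at h00 h01 h11
    refine ⟨?_, h01, ?_⟩
    · have h2 : (2 : k) * ((g : GL (Fin 2) k) 0 0 * (g : GL (Fin 2) k) 1 0) = 0 := by linear_combination h00
      exact (mul_eq_zero.1 h2).resolve_left h20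
    · have h2 : (2 : k) * ((g : GL (Fin 2) k) 0 1 * (g : GL (Fin 2) k) 1 1) = 0 := by linear_combination h11
      exact (mul_eq_zero.1 h2).resolve_left h20
  have hb : ∀ g : ↥(unitaryGroupOfForm (RingHom.id k) !![(0 : k), 1; 1, 0]), (g : GL (Fin 2) k) 0 0 = 0 → (g : GL (Fin 2) k) 0 1 ≠ 0 := by
    intro g ha hb0
    obtain ⟨-, h01, -⟩ := hrel g
    rw [ha, hb0, zero_mul, mul_zero, add_zero] at h01
    exact zero_ne_one h01
  -- the two families are members
  have hdiag : ∀ u : kˣ, (!![(u : k), 0; 0, (↑u⁻¹ : k)]).det ≠ 0 := fun u => by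
    rw [Matrix.det_fin_two_of, mul_zero, sub_zero, Units.mul_inv]; exact one_ne_zero
  have hanti : ∀ u : kˣ, (!![(0 : k), (u : k); (↑u⁻¹ : k), 0]).det ≠ 0 := fun u => by
    rw [Matrix.det_fin_two_of, zero_mul, zero_sub, Units.mul_inv, neg_ne_zero]; exact one_ne_zero
  have hdiagm : ∀ u : kˣ, Matrix.GeneralLinearGroup.mkOfDetNeZero _ (hdiag u) ∈ unitaryGroupOfForm (RingHom.id k) !![(0 : k), 1; 1, 0] := fun u => by
    rw [hmem]
    ext i j
    change ((!![(u : k), 0; 0, (↑u⁻¹ : k)])ᵀ * !![(0 : k), 1; 1, 0] * !![(u : k), 0; 0, (↑u⁻¹ : k)]) i j = _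
    rw [transpose_mul_antidiag_mul_apply]
    fin_cases i <;> fin_cases j <;> simp
  have hantim : ∀ u : kˣ, Matrix.GeneralLinearGroup.mkOfDetNeZero _ (hanti u) ∈ unitaryGroupOfForm (RingHom.id k) !![(0 : k), 1; 1, 0] := fun u => by
    rw [hmem]
    ext i j
    change ((!![(0 : k), (u : k); (↑u⁻¹ : k), 0])ᵀ * !![(0 : k), 1; 1, 0] * !![(0 : k), (u : k); (↑u⁻¹ : k), 0]) i j = _
    rw [transpose_mul_antidiag_mul_apply]
    fin_cases i <;> fin_cases j <;> simp
  have e : ↥(unitaryGroupOfForm (RingHom.id k) !![(0 : k), 1; 1, 0]) ≃ kˣ ⊕ kˣ :=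
    { toFun := fun g => if h : (g : GL (Fin 2) k) 0 0 ≠ 0 then Sum.inl (Units.mk0 _ h) else Sum.inr (Units.mk0 _ (hb g (not_not.1 h)))
      invFun := fun s => Sum.elim (fun u => ⟨Matrix.GeneralLinearGroup.mkOfDetNeZero _ (hdiag u), hdiagm u⟩)
        (fun u => ⟨Matrix.GeneralLinearGroup.mkOfDetNeZero _ (hanti u), hantim u⟩) s
      left_inv := fun g => by
        obtain ⟨hac, h01, hbd⟩ := hrel g
        dsimp only
        by_cases h : (g : GL (Fin 2) k) 0 0 ≠ 0
        · rw [dif_pos h, Sum.elim_inl]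
          have hc : (g : GL (Fin 2) k) 1 0 = 0 := (mul_eq_zero.1 hac).resolve_left h
          rw [hc, zero_mul, add_zero] at h01
          have hd : (g : GL (Fin 2) k) 1 1 = ((g : GL (Fin 2) k) 0 0)⁻¹ := eq_inv_of_mul_eq_one_right h01
          have hd0 : (g : GL (Fin 2) k) 1 1 ≠ 0 := by rw [hd]; exact inv_ne_zero h
          have hb0 : (g : GL (Fin 2) k) 0 1 = 0 := (mul_eq_zero.1 hbd).resolve_right hd0
          refine Subtype.ext (Units.ext (Matrix.ext fun i j => ?_))
          change (!![((g : GL (Fin 2) k) 0 0 : k), 0; 0, (↑(Units.mk0 _ h)⁻¹ : k)]) i j = (g : GL (Fin 2) k) i j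
          fin_cases i <;> fin_cases j
          · rfl
          · exact hb0.symm
          · exact hc.symm
          · change (↑(Units.mk0 _ h)⁻¹ : k) = (g : GL (Fin 2) k) 1 1
            rw [Units.val_inv_eq_inv_val, Units.val_mk0, hd]
        · rw [dif_neg h, Sum.elim_inr]
          have ha : (g : GL (Fin 2) k) 0 0 = 0 := not_not.1 h
          rw [ha, zero_mul, zero_add] at h01
          have hc : (g : GL (Fin 2) k) 1 0 = ((g : GL (Fin 2) k) 0 1)⁻¹ := (eq_inv_of_mul_eq_one_left h01)
          have hd : (g : GL (Fin 2) k) 1 1 = 0 := (mul_eq_zero.1 hbd).resolve_left (hb g ha)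
          refine Subtype.ext (Units.ext (Matrix.ext fun i j => ?_))
          change (!![(0 : k), ((g : GL (Fin 2) k) 0 1 : k); (↑(Units.mk0 _ (hb g ha))⁻¹ : k), 0]) i j = (g : GL (Fin 2) k) i j
          fin_cases i <;> fin_cases j
          · exact ha.symm
          · rfl
          · change (↑(Units.mk0 _ (hb g ha))⁻¹ : k) = (g : GL (Fin 2) k) 1 0
            rw [Units.val_inv_eq_inv_val, Units.val_mk0, hc]
          · exact hd.symm
      right_inv := fun s => by
        rcases s with u | u
        · have h : ((Matrix.GeneralLinearGroup.mkOfDetNeZero _ (hdiag u) : GL (Fin 2) k) 0 0 : k) ≠ 0 := by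
            change ((!![(u : k), 0; 0, (↑u⁻¹ : k)]) 0 0) ≠ 0
            simp
          simp only [Sum.elim_inl]
          rw [dif_pos h]
          congr 1
          exact Units.ext (by simp [Matrix.GeneralLinearGroup.mkOfDetNeZero])
        · have h : ¬ ((Matrix.GeneralLinearGroup.mkOfDetNeZero _ (hanti u) : GL (Fin 2) k) 0 0 : k) ≠ 0 := by
            rw [not_not]
            change ((!![(0 : k), (u : k); (↑u⁻¹ : k), 0]) 0 0) = 0
            simp
          simp only [Sum.elim_inr]
          rw [dif_neg h]
          congr 1
          exact Units.ext (by simp [Matrix.GeneralLinearGroup.mkOfDetNeZero]) }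
  rw [Nat.card_congr e, Nat.card_sum, Nat.card_eq_fintype_card, Fintype.card_units]
  ring

/-! ## §3 The anisotropic plane: `#O(⟨1, −d⟩)(𝔽_q) = 2(q + 1)` for `d` a non-square -/

omit [Fintype k] [DecidableEq k] in
/-- Entries of `gᵀ · diag(1, −d) · g`: `(i,j) ↦ g₀ᵢ g₀ⱼ − d·g₁ᵢ g₁ⱼ`. [folklore] -/
private theorem transpose_mul_diag_mul_apply (g : Matrix (Fin 2) (Fin 2) k) (d : k) (i j : Fin 2) :
    (gᵀ * !![(1 : k), 0; 0, -d] * g) i j = g 0 i * g 0 j - d * (g 1 i * g 1 j) := by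
  simp [Matrix.mul_apply, Fin.sum_univ_two, Matrix.transpose_apply]; ring

omit [Fintype k] [DecidableEq k] in
/-- **Shape of an isometry of `⟨1, −d⟩`** (`d ≠ 0`): if `gᵀ diag(1,−d) g = diag(1,−d)` then, with `a = g₀₀`, `c = g₁₀`, `ε = det g`: `a² − dc² = 1`, `g₀₁ = ε·d·c`, `g₁₁ = ε·a`,
`ε² = 1`. [cite: LidlNiederreiter1996, Ch. 6 §2] -/
theorem eq_of_mem_unitaryGroupOfForm_id_diag {d : k} (hd : d ≠ 0) {g : Matrix (Fin 2) (Fin 2) k} (hg : gᵀ * !![(1 : k), 0; 0, -d] * g = !![(1 : k), 0; 0, -d]) :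
    g 0 0 ^ 2 - d * g 1 0 ^ 2 = 1 ∧ g 0 1 = g.det * d * g 1 0 ∧ g 1 1 = g.det * g 0 0 ∧ g.det ^ 2 = 1 := by
  have h00 := congr_fun (congr_fun hg 0) 0
  have h01 := congr_fun (congr_fun hg 0) 1
  have h11 := congr_fun (congr_fun hg 1) 1
  rw [transpose_mul_diag_mul_apply] at h00 h01 h11
  simp only [Matrix.of_apply, Matrix.cons_val', Matrix.cons_val_zero, Matrix.cons_val_one, Matrix.cons_val_fin_one, Matrix.empty_val'] at h00 h01 h11
  have hsq : g 0 0 ^ 2 - d * g 1 0 ^ 2 = 1 := by linear_combination h00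
  have hdet : g.det ^ 2 = 1 := by
    have h := congrArg Matrix.det hg
    rw [Matrix.det_mul, Matrix.det_mul, Matrix.det_transpose, Matrix.det_fin_two_of] at h
    have h' : d * (g.det ^ 2 - 1) = 0 := by linear_combination -h
    have h'' := (mul_eq_zero.1 h').resolve_left hd
    linear_combination h''
  refine ⟨hsq, ?_, ?_, hdet⟩
  · rw [Matrix.det_fin_two]
    linear_combination (-(g 0 1)) * h00 + g 0 0 * h01
  · rw [Matrix.det_fin_two]
    linear_combination (-(g 1 1)) * h00 + g 1 0 * h01

/-- **`#O(⟨1, −d⟩)(𝔽_q) = 2(q + 1)`** for `d` a non-square, `q` odd: `g ↦ ((g₀₀, g₁₀), det g)` is a bijection onto `{a² − dc² = 1} × {±1}` (inverse `[[a, εdc],[c, εa]]`), and the conic has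
`q + 1` points (§1). [cite: Wilson2009, §3.7] [cite: LidlNiederreiter1996, Ch. 6 §2 Thm. 6.26] -/
theorem natCard_unitaryGroupOfForm_id_diag_one_neg (hF : ringChar k ≠ 2) {d : k} (hd : ¬ IsSquare d) :
    Nat.card ↥(unitaryGroupOfForm (RingHom.id k) !![(1 : k), 0; 0, -d]) = 2 * (Fintype.card k + 1) := by
  have hd0 : d ≠ 0 := fun h => hd (h ▸ IsSquare.zero)
  have h11 : (-1 : k) ≠ 1 := fun h => Ring.two_ne_zero hF (by linear_combination -h)
  have hmem : ∀ g : GL (Fin 2) k, g ∈ unitaryGroupOfForm (RingHom.id k) !![(1 : k), 0; 0, -d] ↔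
      (g : Matrix (Fin 2) (Fin 2) k)ᵀ * !![(1 : k), 0; 0, -d] * (g : Matrix (Fin 2) (Fin 2) k) = !![(1 : k), 0; 0, -d] := fun g => by
    rw [mem_unitaryGroupOfForm_iff, RingHom.coe_id, Matrix.map_id]
  -- the conic
  set C := {p : k × k // p.1 ^ 2 - d * p.2 ^ 2 = 1} with hC
  have hCcard : Nat.card C = Fintype.card k + 1 := by
    rw [hC, Nat.card_eq_fintype_card, Fintype.card_subtype, card_filter_sq_sub_mul_sq_eq_one hF hd]
  -- the two families `[[a, εdc],[c, εa]]`
  have hdet₁ : ∀ p : C, (!![p.1.1, d * p.1.2; p.1.2, p.1.1]).det ≠ 0 := fun p => by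
    rw [Matrix.det_fin_two_of]
    have h : p.1.1 * p.1.1 - d * p.1.2 * p.1.2 = 1 := by linear_combination p.2
    rw [h]; exact one_ne_zero
  have hdet₂ : ∀ p : C, (!![p.1.1, -(d * p.1.2); p.1.2, -p.1.1]).det ≠ 0 := fun p => by
    rw [Matrix.det_fin_two_of]
    have h : p.1.1 * -p.1.1 - -(d * p.1.2) * p.1.2 = -1 := by linear_combination -p.2
    rw [h, neg_ne_zero]; exact one_ne_zero
  have hmem₁ : ∀ p : C, Matrix.GeneralLinearGroup.mkOfDetNeZero _ (hdet₁ p) ∈ unitaryGroupOfForm (RingHom.id k) !![(1 : k), 0; 0, -d] := fun p => by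
    rw [hmem]
    set M : Matrix (Fin 2) (Fin 2) k := !![p.1.1, d * p.1.2; p.1.2, p.1.1] with hM
    have e00 : M 0 0 = p.1.1 := rfl
    have e01 : M 0 1 = d * p.1.2 := rfl
    have e10 : M 1 0 = p.1.2 := rfl
    have e11 : M 1 1 = p.1.1 := rfl
    have h := p.2
    refine Matrix.ext fun i j => ?_
    change (Mᵀ * !![(1 : k), 0; 0, -d] * M) i j = _
    rw [transpose_mul_diag_mul_apply]
    fin_cases i <;> fin_cases j
    · change M 0 0 * M 0 0 - d * (M 1 0 * M 1 0) = 1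
      rw [e00, e10]; linear_combination h
    · change M 0 0 * M 0 1 - d * (M 1 0 * M 1 1) = 0
      rw [e00, e01, e10, e11]; ring
    · change M 0 1 * M 0 0 - d * (M 1 1 * M 1 0) = 0
      rw [e00, e01, e10, e11]; ring
    · change M 0 1 * M 0 1 - d * (M 1 1 * M 1 1) = -d
      rw [e01, e11]; linear_combination (-d) * h
  have hmem₂ : ∀ p : C, Matrix.GeneralLinearGroup.mkOfDetNeZero _ (hdet₂ p) ∈ unitaryGroupOfForm (RingHom.id k) !![(1 : k), 0; 0, -d] := fun p => by
    rw [hmem]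
    set M : Matrix (Fin 2) (Fin 2) k := !![p.1.1, -(d * p.1.2); p.1.2, -p.1.1] with hM
    have e00 : M 0 0 = p.1.1 := rfl
    have e01 : M 0 1 = -(d * p.1.2) := rfl
    have e10 : M 1 0 = p.1.2 := rfl
    have e11 : M 1 1 = -p.1.1 := rfl
    have h := p.2
    refine Matrix.ext fun i j => ?_
    change (Mᵀ * !![(1 : k), 0; 0, -d] * M) i j = _
    rw [transpose_mul_diag_mul_apply]
    fin_cases i <;> fin_cases j
    · change M 0 0 * M 0 0 - d * (M 1 0 * M 1 0) = 1
      rw [e00, e10]; linear_combination h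
    · change M 0 0 * M 0 1 - d * (M 1 0 * M 1 1) = 0
      rw [e00, e01, e10, e11]; ring
    · change M 0 1 * M 0 0 - d * (M 1 1 * M 1 0) = 0
      rw [e00, e01, e10, e11]; ring
    · change M 0 1 * M 0 1 - d * (M 1 1 * M 1 1) = -d
      rw [e01, e11]; linear_combination (-d) * h
  -- first column of a member lies on the conic
  have hcol : ∀ g : ↥(unitaryGroupOfForm (RingHom.id k) !![(1 : k), 0; 0, -d]),
      ((g : GL (Fin 2) k) 0 0, (g : GL (Fin 2) k) 1 0) ∈ {p : k × k | p.1 ^ 2 - d * p.2 ^ 2 = 1} := fun g =>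
    (eq_of_mem_unitaryGroupOfForm_id_diag hd0 ((hmem g.1).1 g.2)).1
  have e : ↥(unitaryGroupOfForm (RingHom.id k) !![(1 : k), 0; 0, -d]) ≃ C ⊕ C :=
    { toFun := fun g => if ((g : GL (Fin 2) k) : Matrix (Fin 2) (Fin 2) k).det = 1 then Sum.inl ⟨_, hcol g⟩ else Sum.inr ⟨_, hcol g⟩
      invFun := fun s => Sum.elim (fun p => ⟨Matrix.GeneralLinearGroup.mkOfDetNeZero _ (hdet₁ p), hmem₁ p⟩)
        (fun p => ⟨Matrix.GeneralLinearGroup.mkOfDetNeZero _ (hdet₂ p), hmem₂ p⟩) s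
      left_inv := fun g => by
        obtain ⟨-, h01, h11', hdet⟩ := eq_of_mem_unitaryGroupOfForm_id_diag hd0 ((hmem g.1).1 g.2)
        dsimp only
        by_cases h : ((g : GL (Fin 2) k) : Matrix (Fin 2) (Fin 2) k).det = 1
        · rw [if_pos h, Sum.elim_inl]
          rw [h, one_mul] at h01 h11'
          refine Subtype.ext (Units.ext (Matrix.ext fun i j => ?_))
          change (!![((g : GL (Fin 2) k) 0 0 : k), d * (g : GL (Fin 2) k) 1 0; (g : GL (Fin 2) k) 1 0, (g : GL (Fin 2) k) 0 0]) i j = (g : GL (Fin 2) k) i j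
          fin_cases i <;> fin_cases j
          · rfl
          · exact h01.symm
          · rfl
          · exact h11'.symm
        · rw [if_neg h, Sum.elim_inr]
          have h' : ((g : GL (Fin 2) k) : Matrix (Fin 2) (Fin 2) k).det = -1 := by
            have hsq : ((g : GL (Fin 2) k) : Matrix (Fin 2) (Fin 2) k).det * ((g : GL (Fin 2) k) : Matrix (Fin 2) (Fin 2) k).det = 1 := by
              rw [← pow_two]; exact hdet
            rcases mul_self_eq_one_iff.1 hsq with h1 | h1
            · exact absurd h1 h
            · exact h1
          rw [h', neg_one_mul] at h11'
          rw [h'] at h01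
          refine Subtype.ext (Units.ext (Matrix.ext fun i j => ?_))
          change (!![((g : GL (Fin 2) k) 0 0 : k), -(d * (g : GL (Fin 2) k) 1 0); (g : GL (Fin 2) k) 1 0, -(g : GL (Fin 2) k) 0 0]) i j = (g : GL (Fin 2) k) i j
          fin_cases i <;> fin_cases j
          · rfl
          · change -(d * (g : GL (Fin 2) k) 1 0) = (g : GL (Fin 2) k) 0 1
            rw [h01]; ring
          · rfl
          · exact h11'.symm
      right_inv := fun s => by
        rcases s with p | p
        · have h : ((Matrix.GeneralLinearGroup.mkOfDetNeZero _ (hdet₁ p) : GL (Fin 2) k) : Matrix (Fin 2) (Fin 2) k).det = 1 := by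
            change (!![p.1.1, d * p.1.2; p.1.2, p.1.1]).det = 1
            rw [Matrix.det_fin_two_of]; linear_combination p.2
          simp only [Sum.elim_inl]
          rw [if_pos h]
          exact congrArg Sum.inl (Subtype.ext rfl)
        · have h : ¬ ((Matrix.GeneralLinearGroup.mkOfDetNeZero _ (hdet₂ p) : GL (Fin 2) k) : Matrix (Fin 2) (Fin 2) k).det = 1 := by
            change ¬ (!![p.1.1, -(d * p.1.2); p.1.2, -p.1.1]).det = 1
            rw [Matrix.det_fin_two_of]
            have h : p.1.1 * -p.1.1 - -(d * p.1.2) * p.1.2 = -1 := by linear_combination -p.2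
            rw [h]; exact h11
          simp only [Sum.elim_inr]
          rw [if_neg h]
          exact congrArg Sum.inr (Subtype.ext rfl) }
  rw [Nat.card_congr e, Nat.card_sum, hCcard]
  ring

end Literature.GroupTheory.SpecificGroups

end
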